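import Summits.Schanuel.Schanuel.Theorems.DiophantineDichotomyKhovanskiiApproxTypeEvDefs
import HarnessLib

/-!
# Vocabulary of line `rare-field-species` for crux `KhovanskiiApproxTypeEv` (stmt-Schanuel-14972)

Route `DiophantineDichotomy` (sub-problem `Schanuel/Schanuel`), crux
`Summit.Schanuel.Schanuel.Theses.DiophantineDichotomy.KhovanskiiApproxTypeEv` (the EVENTUAL-in-the-height
measure of simultaneous algebraic approximation `‖γ − θ‖ ≥ exp(−C(dᵃ log H + dᵇ))` for `H ≥ H₀(d)`,
`a < 1/(n−1)`, at every free Khovanskii point `θ = (s, e^s) ∈ ℂ²ⁿ`, `n ≥ 2`).  This is the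
**definitions module** of the SUPPORT skeleton `Cruxes/KhovanskiiApproxTypeEv/Lines/rare_field_species.lean`
(idea card `Cruxes/KhovanskiiApproxTypeEv/Ideas/rare-field-species.md`, crux-plan
`planner-cruxplan-stmt-Schanuel-14972-rare-field-species-0`, line lead `prover-line-stmt-Schanuel-14972-a4-0`,
`Cruxes/KhovanskiiApproxTypeEv/PICKED.md`): it carries, sorry-free and VERBATIM from the checked skeleton,
the line's VOCABULARY (§1: the naive Lindemann–Weierstrass layer `EvLW n`, its non-LW complement
`EvNonLWRankThreeUp`, the `(d,h)`-currency eventual types `ApproxTypeDhEvYAt` / `ApproxTypeDhEvAt`, the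
layer statements `EvLWDh` / `EvLWBalanced`), the three registered STUB STATEMENTS as named `Prop`s (§2:
`LWPointFree`, `DhOfPrimitiveY`, `BalancedOfDhY` — registered stubs `stub_lwPointFree`,
`stub_dhOfPrimitiveY`, `stub_balancedOfDhY` on stmt-Schanuel-14972), the certificate-game profile
`gameProfile` (§3) and the named missing input `ExpNotAbelianLiouville` with its predicate
`IsAbelianAlgebraic` (§4), so that the stub files
`Theorems/DiophantineDichotomyKhovanskiiApproxTypeEvRareField<Name>.lean` (`--supports stmt-Schanuel-14972`)
and the composition files share ONE copy of every object — exactly the pattern of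
`Theorems/DiophantineDichotomyKhovanskiiApproxTypeEvDefs.lean` (line `anchored-reduction`).  Nothing here
is asserted: every `def … : Prop` is a statement to be proved by a registered stub, a predicate, or
(`ExpNotAbelianLiouville`) an OPEN named input that is only ever a hypothesis; the one `theorem` is the
bookkeeping implication `approxTypeDhEvAt_of_Y`.

## The line in one paragraph (negative knowledge; NO `KhovanskiiApproxTypeEv_of` by design)

The crux as filed is kernel-certified `⟺ EvNonLWTwo ∧ EvRankThreeUp` (p125111) and
`⟹ e ⊥ π ∧ πi ⊥ log 2 ∧ log 2 ⊥ log 3` (p125943).  The card isolates a THIRD open piece inside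
`EvRankThreeUp`: the NAIVE-currency Lindemann–Weierstrass layer `EvLW n` (`s ∈ ℚ̄ⁿ`), `n ≥ 3`, which is
capped at the certificate-game value `(n+1)/(2n) > 1/(n−1)` for every `(degree, absolute height)`-priced
input by rare entangled challengers (Boolean composita, abelian `(ℤ/p)²` squares, `(ℤ/p)^{2n}` spread
fields), and shows the escape hatch: in `(d,h)` currency the LW layer `EvLWDh` is theorem-grade at EVERY
rank with exponent `1 + 1/n` (Ably 1994, `stub_lwPenaltyMeasure`, PROVED p121092, through the penalty
transfer `stub_penaltyTransfer`, p85905) modulo the threshold bookkeeping `DhOfPrimitiveY`; its naive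
shadow `EvLWBalanced` holds on balanced challengers modulo `BalancedOfDhY`.

Currency (as in the crux): `d` bounds `[ℚ(γ):ℚ]`, `H` the naive height of non-zero integer polynomials
of degree `≤ d` vanishing at the coordinates of the challenger `γ`; sup norm on `Fin n ⊕ Fin n → ℂ`;
`m` / `(minpoly ℚ (γ i)).natDegree` the degree over `ℚ` of a coordinate.
-/

noncomputable section

-- `Summit.Schanuel.Schanuel.…` is the mandated summit/sub-problem namespace (single-conjunct summit), hence:
set_option linter.dupNamespace false

namespace Summit.Schanuel.Schanuel.Cruxes.KhovanskiiApproxTypeEv.RareFieldSpecies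

open Summit.Schanuel.Schanuel.Cruxes.KhovanskiiApproxType.LwSmallHeight (IsFreeKhovanskii)
open Summit.Schanuel.Schanuel.Cruxes.KhovanskiiApproxType.HeightWindowCompactness
  (PrimitiveApproxMeasureX)
open Summit.Schanuel.Schanuel.Cruxes.KhovanskiiApproxTypeEv.AnchoredReduction (ApproxTypeEvAt)

/-! ## §1 Vocabulary: the naive LW layer at rank `n`, the `(d,h)`-currency eventual types -/

/-- `EvLW n` — the NAIVE-CURRENCY LINDEMANN–WEIERSTRASS LAYER of the crux at rank `n`: every
`s ∈ ℚ̄ⁿ` with `ℚ`-linearly independent coordinates has eventual approximation type `a < 1/(n−1)`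
(verbatim the crux's conclusion, `ApproxTypeEvAt`).  `EvLW 2 ↔ EvLWTwo` (PROVED layer, p123471).
For `n ≥ 3` this is the card's THIRD open piece inside `EvRankThreeUp`: method-class-capped at
`(n+1)/(2n) > 1/(n−1)` for every `(degree, absolute height)`-priced input (§4), open for a purely
Diophantine reason (§5), plausibly TRUE with room (rare species have population `H^{O(1)}`). -/
def EvLW (n : ℕ) : Prop :=
  ∀ s : Fin n → ℂ, (∀ i, IsAlgebraic ℚ (s i)) → LinearIndependent ℚ s →
    ∃ a b C : ℝ, a < 1 / ((n : ℝ) - 1) ∧ ApproxTypeEvAt n s a b C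

/-- `EvNonLWRankThreeUp` — the NON-LW part of `EvRankThreeUp`: free Khovanskii points of rank
`n ≥ 3` with a transcendental coordinate (OPEN, Schanuel strength pointwise: `2 ≤ trdeg` already,
p124730; `(1, iπ, log 2)`, `(log 2, log 3, 2πi)` instances p124970).  Untouched by this card. -/
def EvNonLWRankThreeUp : Prop :=
  ∀ (n : ℕ) (s : Fin n → ℂ), 3 ≤ n → LinearIndependent ℚ s → IsFreeKhovanskii n s →
    (∃ i, Transcendental ℚ (s i)) → ∃ a b C : ℝ, a < 1 / ((n : ℝ) - 1) ∧ ApproxTypeEvAt n s a b C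

/-- `(d,h)`-CURRENCY EVENTUAL TYPE `(p, C)` at `θ = (s, e^s)`, charging only the `y`-coordinates:
`C > 0` and for every `d` a threshold `H₀(d)` beyond which every challenger `γ` of level `(d, H)`
(`[ℚ(γ):ℚ] ≤ d`, coordinates roots of non-zero integer polynomials of degree `≤ d`, height `≤ H`)
all of whose `y`-coordinates have degree `≥ m` over `ℚ` (`1 ≤ m ≤ d`) satisfies
`‖γ − θ‖ ≥ exp(−C dᵖ log H / m)` — `log H / m` bounds the absolute logarithmic heights of the
`y`-coordinates up to `log(d+1)/m`, so this is the `(d(γ), d(γ)·h(γ))` currency of Philippon's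
printed approximation property (NesterenkoPhilippon2001 p.61) with exponent `p` on `d`.  No `dᵇ`
term (idle in eventual forms, R0 p126140). -/
def ApproxTypeDhEvYAt (n : ℕ) (s : Fin n → ℂ) (p C : ℝ) : Prop :=
  0 < C ∧ ∀ d : ℕ, ∃ H₀ : ℕ, ∀ (H m : ℕ) (γ : Fin n ⊕ Fin n → ℂ), H₀ ≤ H → 1 ≤ m → m ≤ d →
    Module.finrank ℚ ↥(IntermediateField.adjoin ℚ (Set.range γ)) ≤ d →
    (∀ i, ∃ P : Polynomial ℤ, P ≠ 0 ∧ P.natDegree ≤ d ∧ (∀ k, |P.coeff k| ≤ (H : ℤ)) ∧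
      Polynomial.aeval (γ i) P = 0) →
    (∀ j : Fin n, m ≤ (minpoly ℚ (γ (Sum.inr j))).natDegree) →
    Real.exp (-(C * (d : ℝ) ^ p * Real.log H / m)) ≤ ‖γ - Sum.elim s (Complex.exp ∘ s)‖

/-- The same with ALL `2n` coordinates charged (the natural currency of a restated crux at general
free Khovanskii points, where `z`-coordinates may be transcendental); weaker than the `Y` form
(`approxTypeDhEvAt_of_Y`).  Shape of `ApproxTypeDhEvAt` in `Cruxes/KhovanskiiApproxType/
SketchIdeator2.lean` with the degree measured by `minpoly` (= `finrank ℚ⟮γᵢ⟯`, `adjoin.finrank`). -/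
def ApproxTypeDhEvAt (n : ℕ) (s : Fin n → ℂ) (p C : ℝ) : Prop :=
  0 < C ∧ ∀ d : ℕ, ∃ H₀ : ℕ, ∀ (H m : ℕ) (γ : Fin n ⊕ Fin n → ℂ), H₀ ≤ H → 1 ≤ m → m ≤ d →
    Module.finrank ℚ ↥(IntermediateField.adjoin ℚ (Set.range γ)) ≤ d →
    (∀ i, ∃ P : Polynomial ℤ, P ≠ 0 ∧ P.natDegree ≤ d ∧ (∀ k, |P.coeff k| ≤ (H : ℤ)) ∧
      Polynomial.aeval (γ i) P = 0) →
    (∀ i, m ≤ (minpoly ℚ (γ i)).natDegree) →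
    Real.exp (-(C * (d : ℝ) ^ p * Real.log H / m)) ≤ ‖γ - Sum.elim s (Complex.exp ∘ s)‖

/-- Charging only the `y`-coordinates is stronger than charging all coordinates. -/
theorem approxTypeDhEvAt_of_Y :
    ∀ {n : ℕ} {s : Fin n → ℂ} {p C : ℝ}, ApproxTypeDhEvYAt n s p C → ApproxTypeDhEvAt n s p C := by
  intro n s p C h
  refine ⟨h.1, fun d => ?_⟩
  obtain ⟨H₀, hH₀⟩ := h.2 d
  exact ⟨H₀, fun H m γ hH hm hmd hfr hpoly hdeg =>
    hH₀ H m γ hH hm hmd hfr hpoly fun j => hdeg (Sum.inr j)⟩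

/-- `EvLWDh` — THE LW LAYER IN `(d,h)` CURRENCY AT EVERY RANK, with the generic exponent
`p = 1 + 1/n` (`a = 1/n` in the convention `d^{1+a}` of `KhovanskiiApproxTypeDhEv`): theorem-grade
NOW — Ably 1994 (`stub_lwPenaltyMeasure`, μ = n, PROVED) + relative Siegel in the challenger's ideal
(`stub_penaltyTransfer`, p = (n+1)/n, PROVED) + thresholds (`stub_dhOfPrimitiveY`).  Composition
`evLWDh_of`.  Every rare species of the card leaves this statement's kill surface (their `h_abs` is
large: `log H / m` with `m = d^{(n+1)/(2n)}` resp. `d^{1/2}`). -/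
def EvLWDh : Prop :=
  ∀ (n : ℕ) (s : Fin n → ℂ), 1 ≤ n → (∀ i, IsAlgebraic ℚ (s i)) → LinearIndependent ℚ s →
    ∃ C : ℝ, ApproxTypeDhEvYAt n s (1 + 1 / (n : ℝ)) C

/-- `EvLWBalanced` — THE NAIVE SHADOW of `EvLWDh`: at `s ∈ ℚ̄ⁿ` (`n ≥ 2`, lin. independent) and for
every `x` in the window `1 − 1/(n(n−1)) < x ≤ 1`, the crux's typed bound `exp(−C dᵃ log H)` with
`a = 1 + 1/n − x < 1/(n−1)` holds eventually in `H` for the challengers of level `(d, H)` all of whose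
`y`-coordinates have degree `≥ dˣ` ("balanced" challengers; the full-tuple certificate of §4).  It
documents exactly where the naive layer stops: the complement — some `y`-coordinate of degree
`< d^{1−1/(n(n−1))}` — contains the rare species (profile `gameProfile`, coordinate degree
`d^{(n+1)/(2n)}`; note `(n+1)/(2n) < 1 − 1/(n(n−1))` for `n ≥ 3`).  At `n = 2` the window is
`x > 1/2`, matching the floor `a ≥ 1/2` of `Negative/ConjugateFloor.lean` (conjugate species:
`x = 1/2`).  Composition `evLWBalanced_of`. -/
def EvLWBalanced : Prop :=
  ∀ (n : ℕ) (s : Fin n → ℂ) (x : ℝ), 2 ≤ n → (∀ i, IsAlgebraic ℚ (s i)) → LinearIndependent ℚ s →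
    1 - 1 / ((n : ℝ) * ((n : ℝ) - 1)) < x → x ≤ 1 →
    ∃ a C : ℝ, a < 1 / ((n : ℝ) - 1) ∧ 0 < C ∧ ∀ d : ℕ, ∃ H₀ : ℕ,
      ∀ (H : ℕ) (γ : Fin n ⊕ Fin n → ℂ), H₀ ≤ H →
      Module.finrank ℚ ↥(IntermediateField.adjoin ℚ (Set.range γ)) ≤ d →
      (∀ i, ∃ P : Polynomial ℤ, P ≠ 0 ∧ P.natDegree ≤ d ∧ (∀ k, |P.coeff k| ≤ (H : ℤ)) ∧
        Polynomial.aeval (γ i) P = 0) →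
      (∀ j : Fin n, (d : ℝ) ^ x ≤ ((minpoly ℚ (γ (Sum.inr j))).natDegree : ℝ)) →
      Real.exp (-(C * (d : ℝ) ^ a * Real.log H)) ≤ ‖γ - Sum.elim s (Complex.exp ∘ s)‖

/-! ## §2 The three stub statements (named `Prop`s; registered stubs `stub_lwPointFree`,
`stub_dhOfPrimitiveY`, `stub_balancedOfDhY` on stmt-Schanuel-14972, proved in their own files) -/

/-- STUB 1 statement `LWPointFree` — LINDEMANN–WEIERSTRASS POINTS ARE FREE KHOVANSKII POINTS: every
`s ∈ ℚ̄ⁿ` is a non-degenerate zero of the Khovanskii system `gᵢ = minpoly_ℚ(sᵢ)(zᵢ)` (no `y`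
variables): the exponential Jacobian is `diag(minpolyᵢ′(sᵢ))`, non-zero by separability in
characteristic `0` (`minpoly.irreducible`, `Irreducible.separable`, `Polynomial.Separable.
aeval_derivative_ne_zero`; `MvPolynomial.pderiv` of `Polynomial.toMvPolynomial`/`rename`,
`Matrix.det_diagonal`).  Pattern: `isFreeKhovanskii_const_one` (Negative/LoadBearing.lean),
`isFreeKhovanskii_conjPair`.  Size M. -/
def LWPointFree : Prop :=
  ∀ (n : ℕ) (s : Fin n → ℂ), (∀ i, IsAlgebraic ℚ (s i)) → IsFreeKhovanskii n s

/-- STUB 2 statement `DhOfPrimitiveY` — THRESHOLD BOOKKEEPING: a primitive approximation measure in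
the Ably penalty class with exponent `p ≥ 1` at `ω = e^s ∈ ℂⁿ` (the `y`-half of `θ`) gives the
`(d,h)`-currency eventual type `(p, 2C+1)` at `θ`.  Proof: restrict the challenger to its `y`-part
(`‖γ ∘ inr − e^s‖ ≤ ‖γ − θ‖` by `pi_norm_le_iff_of_nonneg`/`norm_le_pi_norm`;
`finrank ℚ(γ ∘ inr) ≤ finrank ℚ(γ) ≤ d` by `IntermediateField.finiteDimensional_adjoin` +
`finrank_le_of_le_right` + `adjoin.mono`, integrality from the clause via
`LwSmallHeight.natDegree_pos_of_aeval_eq_zero`), apply the measure with `d' = m`, and absorb above the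
threshold `H₀(d) = ⌈exp(max d (exp(κ d log(d+2))))⌉₊`: `C dᵖ(log H + d)/m ≤ 2C dᵖ log H/m`
(`d ≤ log H`) and `exp(κ d log(d+2)) ≤ log H ≤ dᵖ log H/m` (`m ≤ d ≤ dᵖ`, `p ≥ 1`).  Pattern:
`LWLayerPrinted.typed_above_of_pen` / `evAt_two_of_pen`.  Size M. -/
def DhOfPrimitiveY : Prop :=
  ∀ (n : ℕ) (s : Fin n → ℂ) (p κ C : ℝ), 1 ≤ p →
    PrimitiveApproxMeasureX n (Complex.exp ∘ s) p κ C → ∃ C' : ℝ, ApproxTypeDhEvYAt n s p C'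

/-- STUB 3 statement `BalancedOfDhY` — THE BALANCED CLASS: a `(d,h)`-currency eventual type `(p, C)`
gives the naive typed bound `exp(−C d^{p−x} log H)` (same `C`, same thresholds) for the challengers
all of whose `y`-coordinates have degree `≥ dˣ`.  Proof: take `m := min_j deg(γ (inr j))`
(`Finset.univ.inf'`, non-empty as `1 ≤ n`); `1 ≤ m` (`minpoly.natDegree_pos` of an integral element),
`m ≤ deg(γ (inr 0)) = finrank ℚ⟮γ (inr 0)⟯ ≤ d` (`IntermediateField.adjoin.finrank`,
`EPiSimultaneousType.finrank_adjoin_simple_le_of_clause`), and `dˣ ≤ m` gives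
`dᵖ log H / m ≤ d^{p−x} log H` (`Real.rpow_sub`, `log H ≥ 0`).  Size S–M. -/
def BalancedOfDhY : Prop :=
  ∀ (n : ℕ) (s : Fin n → ℂ) (p C x : ℝ), 1 ≤ n → ApproxTypeDhEvYAt n s p C →
    ∀ d : ℕ, ∃ H₀ : ℕ, ∀ (H : ℕ) (γ : Fin n ⊕ Fin n → ℂ), H₀ ≤ H →
      Module.finrank ℚ ↥(IntermediateField.adjoin ℚ (Set.range γ)) ≤ d →
      (∀ i, ∃ P : Polynomial ℤ, P ≠ 0 ∧ P.natDegree ≤ d ∧ (∀ k, |P.coeff k| ≤ (H : ℤ)) ∧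
        Polynomial.aeval (γ i) P = 0) →
      (∀ j : Fin n, (d : ℝ) ^ x ≤ ((minpoly ℚ (γ (Sum.inr j))).natDegree : ℝ)) →
      Real.exp (-(C * (d : ℝ) ^ (p - x) * Real.log H)) ≤ ‖γ - Sum.elim s (Complex.exp ∘ s)‖

/-! ## §3 The certificate-game profile (arithmetic of the method-class cap `(n+1)/(2n)`; the lemmas
`gameProfile_self/_one/_mono/_subadd`, `certificate_value`, `two_certificate_cap`, `threshold_lt_cap`,
`spread_subtuple_certificate` live in `Theorems/KhovanskiiApproxTypeEv/Negative/CertificateGame.lean`)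

MODEL (docstring only).  At a free Khovanskii point of rank `n` price a challenger's `y`-part
`γ = (γ₁,…,γₙ)` by its degree profile `f(J) := log_d [ℚ(γ_J):ℚ]` (monotone, subadditive,
`f([n]) = 1`), `x_j := f({j})`, naive height `H` on every coordinate so that
`h_abs(γ_j) ≈ log H / d^{x_j}`.  Every `(degree, absolute height)`-priced input — singleton floors of
exponent `1` and, for each `m`-sub-tuple `J`, a measure that is a function of `([ℚ(γ_J):ℚ], h_abs(γ_J))`
only, granted at the Dirichlet-optimal shape `exp(−c [ℚ(γ_J):ℚ]^{1+1/m} h_max)` — certifies the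
`d`-exponent `(1+1/m) f(J) − min_{j∈J} x_j`; the adversary profile `gameProfile n m` equalises all
certificates at `(n+1)/(2n)`, which exceeds the crux's threshold `1/(n−1)` iff `n ≥ 3`. -/

/-- The extremal adversary profile of the certificate game: `log_d` of the degree of the field
generated by `m` of the `n` `y`-coordinates of an entangled challenger,
`gameProfile n m = (n+1)m/(n(m+1))` (`n, m` real for convenience; used at `1 ≤ m ≤ n`;
`gameProfile n n = 1`, `gameProfile n 1 = (n+1)/(2n)`). -/
def gameProfile (n m : ℝ) : ℝ := (n + 1) * m / (n * (m + 1))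

/-! ## §4 The named missing input: `e^α` is not `ℚ^{ab}`-Liouville, uniformly in the degree -/

/-- `γ` is an ABELIAN algebraic number: it lies in some cyclotomic field `ℚ(e^{2πi/m})`
(Kronecker–Weber: the same as "`ℚ(γ)/ℚ` is abelian"). -/
def IsAbelianAlgebraic (γ : ℂ) : Prop :=
  ∃ m : ℕ, 0 < m ∧
    γ ∈ IntermediateField.adjoin ℚ ({Complex.exp (2 * Real.pi * Complex.I / (m : ℂ))} : Set ℂ)

/-- **`ExpNotAbelianLiouville` — uniform non-`ℚ^{ab}`-Liouville-ness of `e^α`** (the card's named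
missing input; `def … : Prop`, NOT asserted and NOT a published result — an OPEN statement that is only
ever used as an explicit hypothesis, cf. `abelianChallengers_repelled_of` in
`Theorems/KhovanskiiApproxTypeEv/Negative/CertificateGame.lean`; no method in print proves any exponent
`o(p)` here: Siegel–Shidlovskii over `𝕂` bounds only the max over the `[𝕂:ℚ]` conjugate forms, and
every Liouville endgame in `ℚ(γ)` re-derives `c·p` — the loss recorded by
`Literature.Barriers.Schanuel.shidlovskii_rankBound`): for algebraic `α ≠ 0` there are `κ, C` such
that for every degree budget `p`, beyond a threshold `H₀(p)`, every ABELIAN algebraic `γ` that is a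
root of a non-zero integer polynomial of degree `≤ p` and height `≤ H` satisfies
`|e^α − γ| ≥ exp(−(κ log H + C p))` — degree exponent ZERO in front of `log H`.  Heuristic truth by
Borel–Cantelli over the `p^{O(1)} H^{O(1)} (log H)^{O(log p)}` abelian numbers of degree `≤ p` and
height `≤ H` (`κ ≥ 3` is forced for REAL `e^α` by Davenport–Schmidt; the `∃ κ` shape survives).
Vocabulary: Schmidt's `𝕂`-Liouville numbers; shape: Roth–LeVeque for a TRANSCENDENTAL target. -/
def ExpNotAbelianLiouville : Prop :=
  ∀ α : ℂ, IsAlgebraic ℚ α → α ≠ 0 → ∃ κ C : ℝ, 0 < κ ∧ ∀ p : ℕ, ∃ H₀ : ℕ, ∀ (H : ℕ) (γ : ℂ),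
    H₀ ≤ H → IsAbelianAlgebraic γ →
    (∃ P : Polynomial ℤ, P ≠ 0 ∧ P.natDegree ≤ p ∧ (∀ k, |P.coeff k| ≤ (H : ℤ)) ∧
      Polynomial.aeval γ P = 0) →
    Real.exp (-(κ * Real.log H + C * p)) ≤ ‖Complex.exp α - γ‖

end Summit.Schanuel.Schanuel.Cruxes.KhovanskiiApproxTypeEv.RareFieldSpecies

end
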